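import Summits.CriticalPhenomena.PercolationContinuityZ3.Theorems.Transplant.KNParaChainSchedN
import HarnessLib

/-!
# N1 (the `{±1}` node), LEVEL 1, (C) column file (C-N2): the FIXED-STRIDE LOCALISATION ROUNDS `ChainPara.LocPrm` — the N1 twin of D″'s `Loc`
# (`KNCells2ChainLocalise`): SYMMETRIC cores `{|along| ≤ L k, |across| ≤ W + k·e}` about a centre, every walker striding TOWARDS the centre line
# (its own sign `σ`, inside the route `∃`), ONE stride extent `[sLo, sHi]` (no certified interval), steered pieces `[0, Pp]` / `[−Pm, 0]` read in the
# walker's sign, and the along half-width CONTRACTING BY WHOLE STRIDES: `L (k+1) = max (L k + e − sLo) sHi` — down to ONE stride, never to a point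
# (C-FUNNEL.md (N-a): piece choice confines, only the per-walker sign contracts).  Rendered as p1-g11's slab-target schedule `ChainPlanar.ScheduleN`
# (`LocPrm.scheduleN`), so the window chain `SkelPhiWinChainF` and the room `roomN` apply verbatim.  Pure `ℤ` / `Site 2`.

builds on p205010 (kernel theorem, internal audit signed; external expert review pending) — nothing in this file uses p205010; nothing here is a
claim about the open node `SamePDropOfSkeletonNeg`.
Lane `prim-bschramm`, seat `prim-bschramm-p5` (gen 8; (C) lineage; design: HOME/prim-bschramm-p5-g8/C-FUNNEL.md — phase 1 = signed v-rounds over the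
coarse skeleton ρ, phase 2 = signed u-rounds in the run frame `runX`; both are instances of THIS record); helper file (`--supports stmt-CriticalPhenomena-4575`).
* §1 `LocPrm`, `LocOK`; §2 `L`, `Wk`, `InCore/InEnl/InRegion/InPrism`, `dir` (stride sign towards the centre), `steerT` (piece towards the centre line, read in
  the walker's sign), `InPiece`, **`L_le_of_rounds`** (`L k ≤ max (L0 − k·(sLo − e)) sHi`), **`L_eq_sHi`**; §3 **`route`**, `inRegion_of_link`, `inRegion_of_inCore_succ`,
  `inPrism_of_inRegion`, `inCore_zero_iff`; §4 **`LocPrm.scheduleN P a c hP : ScheduleN`** (axis `a`, centre `c`; `R' := e`, `d := 0`) + rfl API, `mem_scheduleN_core_iff/_zero/_last`.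
[cite: KozmaNitzan2024, §4 Lemma 12 (pp. 23–25: the rounds into the target box), Lemma 11 (pp. 22–23)] [cite: MartineauTassion2017, §4.3 Lemma 4.2 (piece choice by position)]
-/

noncomputable section

namespace Summit.CriticalPhenomena.PercolationContinuityZ3.Theorems.Transplant

namespace ChainPara

open Literature.Probability.Percolation Literature.Probability.LatticeModels
open Literature.Probability.Percolation.KozmaNitzan.Cells (oth oth_ne eq_oth_of_ne)
open ChainPlanar

/-! ## §1 Parameters and admissibility -/

/-- **Parameters of a fixed-stride localisation**: stride progress `[sLo, sHi]`, landing pieces `[0, Pp]` / `[−Pm, 0]`, transverse half-window `W`,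
isotropic siting slack `e` (the schedule's `R'`), link box `La × Lb`, initial along half-width `L0`, rounds `0, …, N`. [this work] -/
structure LocPrm where
  /-- minimal along-progress of one stride -/
  sLo : ℤ
  /-- maximal along-progress of one stride -/
  sHi : ℤ
  /-- the `τ = 1` landing piece is `[0, Pp]` (transverse, read in the walker's sign) -/
  Pp : ℕ
  /-- the `τ = −1` landing piece is `[−Pm, 0]` -/
  Pm : ℕ
  /-- transverse half-window about the centre line (round `0`) -/
  W : ℕ
  /-- siting slack per round (seed centre vs contact), both directions -/
  e : ℕ
  /-- along half-size of the link box of one stride about the seed centre -/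
  La : ℕ
  /-- transverse half-size of the link box -/
  Lb : ℕ
  /-- along half-width of core `0` -/
  L0 : ℕ
  /-- the rounds are `0, …, N` -/
  N : ℕ

/-- **Admissible localisation parameters**: nonnegative stride progress fitting in the link box, both pieces inside the transverse window, siting slack
at most the minimal progress (so the along half-width never grows). [this work] -/
structure LocOK (P : LocPrm) : Prop where
  /-- strides do not go backwards -/
  hs0 : 0 ≤ P.sLo
  /-- the stride interval is an interval -/
  hs : P.sLo ≤ P.sHi
  /-- one stride's landing lies in its link box (along) -/
  hsL : P.sHi ≤ P.La
  /-- the upper piece fits in the window -/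
  hPp : P.Pp ≤ P.W
  /-- the lower piece fits in the window -/
  hPm : P.Pm ≤ P.W
  /-- the siting slack is at most the minimal progress -/
  he : (P.e : ℤ) ≤ P.sLo

namespace LocPrm

variable (P : LocPrm)

/-! ## §2 Cores, enlarged cores, regions, the prism, signs, pieces -/

/-- **Along half-width of core `k`**: `L 0 = L0`, `L (k+1) = max (L k + e − sLo) sHi` (a walker at most `L k + e` off the centre line strides towards it
by at least `sLo`, at most `sHi`). [cite: KozmaNitzan2024, §4 Lemma 12 (pp. 23–25)] -/
def L (P : LocPrm) : ℕ → ℤ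
  | 0 => P.L0
  | k + 1 => max (L P k + P.e - P.sLo) P.sHi

/-- **Transverse half-width of core `k`**: `W + k·e`. [this work] -/
def Wk (k : ℕ) : ℤ := P.W + (k : ℤ) * P.e

/-- `L 0 = L0`. [folklore] -/
@[simp] theorem L_zero : P.L 0 = P.L0 := by simp [L]

/-- `L (k+1) = max (L k + e − sLo) sHi`. [folklore] -/
theorem L_succ (k : ℕ) : P.L (k + 1) = max (P.L k + P.e - P.sLo) P.sHi := by simp [L]

/-- **Core `k`**: `|a| ≤ L k`, `|b| ≤ W + k·e` (contacts after `k` rounds, along / transverse offsets from the centre). [cite: KozmaNitzan2024, §4 Lemma 12] -/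
def InCore (k : ℕ) (a b : ℤ) : Prop := |a| ≤ P.L k ∧ |b| ≤ P.Wk k

/-- **Enlarged core `k`** (seed centres sited within `e` of a contact of core `k`). [this work] -/
def InEnl (k : ℕ) (a b : ℤ) : Prop := |a| ≤ P.L k + P.e ∧ |b| ≤ P.Wk k + P.e

/-- **Region `k`** (holds the link box of every stride started from the enlarged core `k`). [cite: KozmaNitzan2024, §4 Lemma 11 (p. 22)] -/
def InRegion (k : ℕ) (a b : ℤ) : Prop := |a| ≤ P.L k + P.e + P.La ∧ |b| ≤ P.Wk k + P.e + P.Lb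

/-- **The prism** (one symmetric box holding every region `k ≤ N`). [cite: KozmaNitzan2024, §4 Lemma 11 (p. 22: Ω)] -/
def InPrism (a b : ℤ) : Prop := |a| ≤ max (P.L0 : ℤ) P.sHi + P.e + P.La ∧ |b| ≤ P.Wk P.N + P.e + P.Lb

/-- **The stride sign towards the centre line**: `−1` from the nonnegative side, `+1` from the negative side. [cite: KozmaNitzan2024, §4 Lemma 12 (the rounds)] -/
def dir (a : ℤ) : ℤ := if 0 ≤ a then -1 else 1

/-- **The steered piece towards the centre line, read in the walker's sign `σ`**: `−1` when `σ·b ≥ 0`, else `+1`. [cite: MartineauTassion2017, §4.3 Lemma 4.2] -/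
def steerT (σ b : ℤ) : ℤ := if 0 ≤ σ * b then -1 else 1

/-- The landing piece of sign `τ`, as a predicate on the signed transverse offset `δ`. [cite: MartineauTassion2017, §3.2] -/
def InPiece (τ δ : ℤ) : Prop := (τ = 1 → 0 ≤ δ ∧ δ ≤ P.Pp) ∧ (τ = -1 → -(P.Pm : ℤ) ≤ δ ∧ δ ≤ 0)

/-- `dir a = 1 ∨ dir a = −1`. [folklore] -/
theorem dir_eq_or (a : ℤ) : dir a = 1 ∨ dir a = -1 := by unfold dir; split_ifs <;> simp

/-- `steerT σ b = 1 ∨ steerT σ b = −1`. [folklore] -/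
theorem steerT_eq_or (σ b : ℤ) : steerT σ b = 1 ∨ steerT σ b = -1 := by unfold steerT; split_ifs <;> simp

/-- `sHi ≤ L (k+1)`. [folklore] -/
theorem sHi_le_L_succ (k : ℕ) : P.sHi ≤ P.L (k + 1) := by
  rw [L_succ]; exact le_max_right _ _

variable {P}

/-- `0 ≤ L k` (from `0 ≤ sHi`). [folklore] -/
theorem L_nonneg (hP : LocOK P) (k : ℕ) : 0 ≤ P.L k := by
  cases k with
  | zero => simp
  | succ k => exact (hP.hs0.trans hP.hs).trans (P.sHi_le_L_succ k)

/-- `0 ≤ Wk k`. [folklore] -/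
theorem Wk_nonneg (P : LocPrm) (k : ℕ) : 0 ≤ P.Wk k := by unfold Wk; positivity

/-- `Wk k + e = Wk (k+1)`. [folklore] -/
theorem Wk_succ (P : LocPrm) (k : ℕ) : P.Wk (k + 1) = P.Wk k + P.e := by unfold Wk; push_cast; ring

/-- `Wk` is monotone. [folklore] -/
theorem Wk_mono (P : LocPrm) {k k' : ℕ} (h : k ≤ k') : P.Wk k ≤ P.Wk k' := by
  unfold Wk
  have : (k : ℤ) ≤ k' := by exact_mod_cast h
  nlinarith [Int.natCast_nonneg P.e]

/-- **The along half-width never grows beyond `max (L k) sHi`** (siting slack `e ≤ sLo`). [folklore] -/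
theorem L_succ_le (hP : LocOK P) (k : ℕ) : P.L (k + 1) ≤ max (P.L k) P.sHi := by
  rw [L_succ]
  exact max_le_max (by linarith [hP.he]) le_rfl

/-- `L k ≤ max L0 sHi`. [folklore] -/
theorem L_le_max (hP : LocOK P) (k : ℕ) : P.L k ≤ max (P.L0 : ℤ) P.sHi := by
  induction k with
  | zero => simp
  | succ k ih => exact (L_succ_le hP k).trans (max_le (ih) (le_max_right _ _))

/-- **Contraction by whole strides**: after `k` rounds `L k ≤ max (L0 − k·(sLo − e)) sHi`. [cite: KozmaNitzan2024, §4 Lemma 12 (pp. 23–25)] -/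
theorem L_le_of_rounds (hP : LocOK P) (k : ℕ) : P.L k ≤ max ((P.L0 : ℤ) - (k : ℤ) * (P.sLo - P.e)) P.sHi := by
  induction k with
  | zero => simp
  | succ k ih =>
    rw [L_succ]
    refine max_le ?_ (le_max_right _ _)
    rcases le_max_iff.1 ih with h | h
    · refine le_max_of_le_left ?_
      push_cast; nlinarith
    · exact le_max_of_le_right (by linarith [hP.he])

/-- **The along half-width IS one stride extent after enough rounds**: `L k = sHi` once `1 ≤ k` and `L0 ≤ sHi + k·(sLo − e)`. [cite: KozmaNitzan2024, §4 Lemma 12] -/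
theorem L_eq_sHi (hP : LocOK P) {k : ℕ} (hk : 1 ≤ k) (hL : (P.L0 : ℤ) ≤ P.sHi + (k : ℤ) * (P.sLo - P.e)) : P.L k = P.sHi := by
  refine le_antisymm ?_ ?_
  · refine (L_le_of_rounds hP k).trans (max_le (by linarith) le_rfl)
  · obtain ⟨k', rfl⟩ := Nat.exists_eq_add_of_le' hk
    exact P.sHi_le_L_succ k'

/-! ## §3 The route of one round -/

/-- **The link box about an enlarged-core point lies in the region.** [cite: KozmaNitzan2024, §4 Lemma 11 (p. 22)] -/
theorem inRegion_of_link {k : ℕ} {a b a' b' : ℤ} (hv : P.InEnl k a b) (ha : |a' - a| ≤ P.La) (hb : |b' - b| ≤ P.Lb) : P.InRegion k a' b' := by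
  obtain ⟨h1, h2⟩ := hv
  constructor
  · calc |a'| = |(a' - a) + a| := by ring_nf
      _ ≤ |a' - a| + |a| := abs_add_le _ _
      _ ≤ P.La + (P.L k + P.e) := add_le_add ha h1
      _ = P.L k + P.e + P.La := by ring
  · calc |b'| = |(b' - b) + b| := by ring_nf
      _ ≤ |b' - b| + |b| := abs_add_le _ _
      _ ≤ P.Lb + (P.Wk k + P.e) := add_le_add hb h2
      _ = P.Wk k + P.e + P.Lb := by ring

/-- **The steered landing of the centre-bound stride lies in the next core**: from an enlarged-core point `(a, b)`, with `σ = dir a` and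
`τ = steerT σ b`, every `(a', b')` with `sLo ≤ σ(a' − a) ≤ sHi` and `σ(b' − b)` in the piece of sign `τ` lies in core `k+1`.
[cite: KozmaNitzan2024, §4 Lemma 12 (pp. 23–25)] [cite: MartineauTassion2017, §4.3 Lemma 4.2] -/
theorem inCore_succ_of_landing (hP : LocOK P) {k : ℕ} {a b a' b' : ℤ} (hv : P.InEnl k a b) (h1 : P.sLo ≤ dir a * (a' - a))
    (h2 : dir a * (a' - a) ≤ P.sHi) (hpc : P.InPiece (steerT (dir a) b) (dir a * (b' - b))) : P.InCore (k + 1) a' b' := by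
  obtain ⟨ha, hb⟩ := hv
  have hs0 := hP.hs0; have hs := hP.hs; have hPp := hP.hPp; have hPm := hP.hPm
  have hPpz : (P.Pp : ℤ) ≤ P.W := by exact_mod_cast hPp
  have hPmz : (P.Pm : ℤ) ≤ P.W := by exact_mod_cast hPm
  have hWk : (P.W : ℤ) ≤ P.Wk k := by unfold Wk; nlinarith [Int.natCast_nonneg P.e, Int.natCast_nonneg k]
  rw [abs_le] at ha hb
  constructor
  · -- along: `|a'| ≤ max (L k + e − sLo) sHi`
    rw [L_succ, abs_le]
    by_cases h0 : 0 ≤ a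
    · have hd : dir a = -1 := by simp [dir, h0]
      rw [hd] at h1 h2
      constructor
      · have := le_max_right (P.L k + P.e - P.sLo) P.sHi; linarith
      · have := le_max_left (P.L k + P.e - P.sLo) P.sHi; linarith
    · have hd : dir a = 1 := by simp [dir, h0]
      rw [hd] at h1 h2
      push Not at h0
      constructor
      · have := le_max_left (P.L k + P.e - P.sLo) P.sHi; linarith
      · have := le_max_right (P.L k + P.e - P.sLo) P.sHi; linarith
  · -- transverse: `|b'| ≤ W + (k+1) e`
    rw [Wk_succ, abs_le]
    obtain ⟨hp1, hm1⟩ := hpc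
    by_cases h0 : 0 ≤ a
    · have hd : dir a = -1 := by simp [dir, h0]
      rw [hd] at hp1 hm1
      by_cases hb0 : b ≤ 0
      · have ht : steerT (-1) b = -1 := by unfold steerT; rw [if_pos (by linarith)]
        have := hm1 ht
        constructor <;> nlinarith
      · have ht : steerT (-1) b = 1 := by unfold steerT; rw [if_neg (by linarith)]
        have := hp1 ht
        constructor <;> nlinarith
    · have hd : dir a = 1 := by simp [dir, h0]
      rw [hd] at hp1 hm1
      by_cases hb0 : 0 ≤ b
      · have ht : steerT 1 b = -1 := by unfold steerT; rw [if_pos (by linarith)]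
        have := hm1 ht
        constructor <;> nlinarith
      · have ht : steerT 1 b = 1 := by unfold steerT; rw [if_neg (by linarith)]
        have := hp1 ht
        constructor <;> nlinarith

/-- **THE ROUTE OF ONE LOCALISATION ROUND**: from every point `(a, b)` of the enlarged core `k`, the link box `La × Lb` lies in region `k`, and the steered
landing of the centre-bound stride (`σ = dir a`, piece `τ = steerT σ b`) lies in core `k + 1`. [cite: KozmaNitzan2024, §4 Lemma 12 (pp. 23–25)]
[cite: MartineauTassion2017, §4.3 Lemma 4.2] -/
theorem route (hP : LocOK P) {k : ℕ} {a b : ℤ} (hv : P.InEnl k a b) :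
    (∀ a' b', |a' - a| ≤ P.La → |b' - b| ≤ P.Lb → P.InRegion k a' b') ∧
    (∀ a' b', P.sLo ≤ dir a * (a' - a) → dir a * (a' - a) ≤ P.sHi → P.InPiece (steerT (dir a) b) (dir a * (b' - b)) →
      P.InCore (k + 1) a' b') :=
  ⟨fun _ _ ha hb => inRegion_of_link hv ha hb, fun _ _ h1 h2 hpc => inCore_succ_of_landing hP hv h1 h2 hpc⟩

/-- **The next core lies in the region** (`sHi ≤ La`, `e ≤ sLo`). [folklore] -/
theorem inRegion_of_inCore_succ (hP : LocOK P) {k : ℕ} {a b : ℤ} (h : P.InCore (k + 1) a b) : P.InRegion k a b := by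
  obtain ⟨ha, hb⟩ := h
  have hsL : (P.sHi : ℤ) ≤ P.La := by exact_mod_cast hP.hsL
  constructor
  · refine ha.trans ?_
    rw [L_succ]
    refine max_le (by linarith [hP.he, hP.hs0, Int.natCast_nonneg P.La]) ?_
    linarith [L_nonneg hP k, Int.natCast_nonneg P.e]
  · rw [Wk_succ] at hb
    exact hb.trans (by linarith [Int.natCast_nonneg P.Lb])

/-- **Every region `k ≤ N` lies in the prism.** [folklore] -/
theorem inPrism_of_inRegion (hP : LocOK P) {k : ℕ} (hk : k ≤ P.N) {a b : ℤ} (h : P.InRegion k a b) : P.InPrism a b := by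
  obtain ⟨ha, hb⟩ := h
  exact ⟨ha.trans (by linarith [L_le_max hP k]), hb.trans (by linarith [Wk_mono P hk])⟩

/-- Core `0` is the start box `{|a| ≤ L0, |b| ≤ W}`. [folklore] -/
theorem inCore_zero_iff {a b : ℤ} : P.InCore 0 a b ↔ |a| ≤ P.L0 ∧ |b| ≤ P.W := by
  simp [InCore, Wk]

/-! ## §4 The localisation rounds as a schedule with slab targets -/

/-- Core `k` rendered on the plane: axis `a`, centre `c` (dBox sign `1`). [this work] -/
def pcore (a : Fin 2) (c : Site 2) (k : ℕ) : Finset (Site 2) := dBox a 1 c (-P.L k) (P.L k) (-P.Wk k) (P.Wk k)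

/-- Region `k` rendered on the plane. [this work] -/
def pregion (a : Fin 2) (c : Site 2) (k : ℕ) : Finset (Site 2) :=
  dBox a 1 c (-(P.L k + P.e + P.La)) (P.L k + P.e + P.La) (-(P.Wk k + P.e + P.Lb)) (P.Wk k + P.e + P.Lb)

/-- The prism rendered on the plane. [this work] -/
def pprism (a : Fin 2) (c : Site 2) : Finset (Site 2) :=
  dBox a 1 c (-(max (P.L0 : ℤ) P.sHi + P.e + P.La)) (max (P.L0 : ℤ) P.sHi + P.e + P.La) (-(P.Wk P.N + P.e + P.Lb)) (P.Wk P.N + P.e + P.Lb)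

variable {a : Fin 2} {c : Site 2}

/-- Planar membership in a core = offsets in the core. [folklore] -/
theorem mem_pcore_iff {k : ℕ} {y : Site 2} : y ∈ P.pcore a c k ↔ P.InCore k (y a - c a) (y (oth a) - c (oth a)) := by
  rw [pcore, mem_dBox_iff (Or.inl rfl)]; simp only [InCore, one_mul, abs_le]

/-- Planar membership in a region = offsets in the region. [folklore] -/
theorem mem_pregion_iff {k : ℕ} {y : Site 2} : y ∈ P.pregion a c k ↔ P.InRegion k (y a - c a) (y (oth a) - c (oth a)) := by
  rw [pregion, mem_dBox_iff (Or.inl rfl)]; simp only [InRegion, one_mul, abs_le]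

/-- Planar membership in the prism = offsets in the prism. [folklore] -/
theorem mem_pprism_iff {y : Site 2} : y ∈ P.pprism a c ↔ P.InPrism (y a - c a) (y (oth a) - c (oth a)) := by
  rw [pprism, mem_dBox_iff (Or.inl rfl)]; simp only [InPrism, one_mul, abs_le]

/-- Planar membership in the `e`-enlarged core = offsets in the enlarged core. [folklore] -/
theorem mem_enlarge_iff {k : ℕ} {y : Site 2} :
    y ∈ dBox a 1 c (-P.L k - P.e) (P.L k + P.e) (-P.Wk k - P.e) (P.Wk k + P.e) ↔ P.InEnl k (y a - c a) (y (oth a) - c (oth a)) := by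
  rw [mem_dBox_iff (Or.inl rfl)]; simp only [InEnl, one_mul, abs_le]; constructor <;> intro h <;> obtain ⟨⟨h1, h2⟩, h3, h4⟩ := h <;>
    exact ⟨⟨by linarith, by linarith⟩, by linarith, by linarith⟩

/-- **THE FIXED-STRIDE LOCALISATION ROUNDS AS A SCHEDULE WITH SLAB TARGETS** (axis `a`, centre `c`; `R' := e`, drift `0`; the stride sign of the route
at `v` is `dir (v_a − c_a)`, the piece `steerT σ (v_{a′} − c_{a′})`). [cite: KozmaNitzan2024, §4 Lemma 12 (pp. 23–25)] [cite: MartineauTassion2017, §4.3 Lemma 4.2] -/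
def scheduleN (P : LocPrm) (a : Fin 2) (c : Site 2) (hP : LocOK P) : ScheduleN where
  ax := fun _ => a
  lo := fun k => dLo a 1 c (-P.L k) (P.L k) (-P.Wk k) (P.Wk k)
  hi := fun k => dHi a 1 c (-P.L k) (P.L k) (-P.Wk k) (P.Wk k)
  region := fun k => P.pregion a c k
  prism := P.pprism a c
  N := P.N
  R' := P.e
  sLo := fun _ => P.sLo
  sHi := fun _ => P.sHi
  d := fun _ => 0
  Pp := fun _ => P.Pp
  Pm := fun _ => P.Pm
  La := fun _ => P.La
  Lb := fun _ => P.Lb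
  encl k _ := by
    rw [dBox_enlarge (Or.inl rfl)]
    intro y hy
    have h := (P.mem_enlarge_iff).1 hy
    exact (P.mem_pregion_iff).2 ⟨h.1.trans (by linarith [Int.natCast_nonneg P.La]), h.2.trans (by linarith [Int.natCast_nonneg P.Lb])⟩
  succ k _ := by
    intro y hy
    exact (P.mem_pregion_iff).2 (inRegion_of_inCore_succ hP ((P.mem_pcore_iff).1 hy))
  sub_prism k hk := by
    intro y hy
    exact (P.mem_pprism_iff).2 (inPrism_of_inRegion hP hk ((P.mem_pregion_iff).1 hy))
  nonempty k _ := dBox_nonempty (Or.inl rfl) c (by linarith [L_nonneg hP k]) (by linarith [Wk_nonneg P k])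
  route k _ v hv := by
    rw [dBox_enlarge (Or.inl rfl)] at hv
    have hv' := (P.mem_enlarge_iff).1 hv
    refine ⟨dir (v a - c a), dir_eq_or _, fun y hya hyb => (P.mem_pregion_iff).2 (inRegion_of_link hv' ?_ ?_), steerT (dir (v a - c a)) (v (oth a) - c (oth a)),
      steerT_eq_or _ _, fun y h1 h2 hpc => (P.mem_pcore_iff).2 (inCore_succ_of_landing hP hv' ?_ ?_ ?_)⟩
    · have : y a - c a - (v a - c a) = y a - v a := by ring
      rw [this]; exact hya
    · have : y (oth a) - c (oth a) - (v (oth a) - c (oth a)) = y (oth a) - v (oth a) := by ring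
      rw [this]; exact hyb
    · have : y a - c a - (v a - c a) = y a - v a := by ring
      rw [this]; exact h1
    · have : y a - c a - (v a - c a) = y a - v a := by ring
      rw [this]; exact h2
    · have : y (oth a) - c (oth a) - (v (oth a) - c (oth a)) = y (oth a) - v (oth a) := by ring
      rw [this]
      simpa [ScheduleN.InPiece, InPiece, sub_zero] using hpc

section API

variable (P : LocPrm) (a : Fin 2) (c : Site 2) (hP : LocOK P)

/-- The cores of the localisation schedule. [folklore] -/
@[simp] theorem scheduleN_core (k : ℕ) : (P.scheduleN a c hP).core k = P.pcore a c k := rfl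

/-- The regions of the localisation schedule. [folklore] -/
@[simp] theorem scheduleN_region (k : ℕ) : (P.scheduleN a c hP).region k = P.pregion a c k := rfl

/-- The prism of the localisation schedule. [folklore] -/
@[simp] theorem scheduleN_prism : (P.scheduleN a c hP).prism = P.pprism a c := rfl

/-- The axis of the localisation schedule. [folklore] -/
@[simp] theorem scheduleN_ax (k : ℕ) : (P.scheduleN a c hP).ax k = a := rfl

/-- The parameters of the localisation schedule. [folklore] -/
theorem scheduleN_params : (P.scheduleN a c hP).N = P.N ∧ (P.scheduleN a c hP).R' = P.e ∧
    (∀ k, (P.scheduleN a c hP).sLo k = P.sLo ∧ (P.scheduleN a c hP).sHi k = P.sHi ∧ (P.scheduleN a c hP).d k = 0 ∧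
      (P.scheduleN a c hP).Pp k = P.Pp ∧ (P.scheduleN a c hP).Pm k = P.Pm ∧ (P.scheduleN a c hP).La k = P.La ∧ (P.scheduleN a c hP).Lb k = P.Lb) :=
  ⟨rfl, rfl, fun _ => ⟨rfl, rfl, rfl, rfl, rfl, rfl, rfl⟩⟩

/-- Membership in core `k` of the localisation schedule: `|y_a − c_a| ≤ L k`, `|y_{a′} − c_{a′}| ≤ W + k·e`. [folklore] -/
theorem mem_scheduleN_core_iff {k : ℕ} {y : Site 2} :
    y ∈ (P.scheduleN a c hP).core k ↔ |y a - c a| ≤ P.L k ∧ |y (oth a) - c (oth a)| ≤ P.Wk k := by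
  rw [scheduleN_core, mem_pcore_iff]; rfl

/-- The start core is the start box `{|y_a − c_a| ≤ L0, |y_{a′} − c_{a′}| ≤ W}`. [folklore] -/
theorem mem_scheduleN_core_zero {y : Site 2} : y ∈ (P.scheduleN a c hP).core 0 ↔ |y a - c a| ≤ P.L0 ∧ |y (oth a) - c (oth a)| ≤ P.W := by
  rw [mem_scheduleN_core_iff]; simp [Wk]

/-- **The last core is one stride wide** once `1 ≤ N + 1` rounds satisfy `L0 ≤ sHi + (N+1)(sLo − e)`: `{|y_a − c_a| ≤ sHi, |y_{a′} − c_{a′}| ≤ W + (N+1)e}`.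
[cite: KozmaNitzan2024, §4 Lemma 12 (pp. 23–25)] -/
theorem mem_scheduleN_core_last (hL : (P.L0 : ℤ) ≤ P.sHi + ((P.N : ℤ) + 1) * (P.sLo - P.e)) {y : Site 2} :
    y ∈ (P.scheduleN a c hP).core (P.N + 1) ↔ |y a - c a| ≤ P.sHi ∧ |y (oth a) - c (oth a)| ≤ P.W + ((P.N : ℤ) + 1) * P.e := by
  rw [mem_scheduleN_core_iff, L_eq_sHi hP (by omega) (by push_cast; exact hL)]
  simp [Wk]

end API

end LocPrm

end ChainPara

end Summit.CriticalPhenomena.PercolationContinuityZ3.Theorems.Transplant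

end
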